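import Mathlib.Analysis.SpecialFunctions.Elliptic.Weierstrass
import Mathlib.Analysis.SpecialFunctions.Exp
import Literature.NumberTheory.EllipticCurves.WeierstrassZeta
import HarnessLib

/-!
# The Weierstrass sigma function of a period lattice

Topic `Literature/NumberTheory/EllipticCurves` (trunk `TranscendEllArithS`). Node D2 of the
decomposition of `Literature.NumberTheory.Transcendental.chudnovsky` (see `Transcendental/ChudnovskyPeriods.lean`): every
transcendence proof about periods and quasi-periods (Schneider 1937; Chudnovsky 1984, Ch. 7, §2–3:
"We use Schwarz' lemma applied to the function `σ(z)^{3L}·F(z)`") multiplies the meromorphic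
auxiliary function `P(z, ℘, ζ)` by a power of the entire function `σ`, whose zeros are exactly the
lattice points, to obtain an entire function of controlled growth.

## Source

E. T. Whittaker, G. N. Watson, *A Course of Modern Analysis*, 4th ed. (1927), §20.42
("`σ(z) = z ∏' {(1 - z/Ω) exp(z/Ω + z²/(2Ω²))}` … the product converges absolutely and uniformly
… `(d/dz) log σ(z) = ζ(z)` … `σ(z)` is an integral function … odd") and §20.421 (the
quasi-periodicity `σ(z + 2ω₁) = -e^{2η₁(z + ω₁)} σ(z)` in the Whittaker–Watson normalisation with
periods `2ωᵢ` and `ηᵢ = ζ(ωᵢ)`; with Mathlib's `PeriodPair` (periods `ωᵢ`) and the tree's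
`PeriodPair.ηᵢ = 2ζ(ωᵢ/2)` this reads `σ(z + ωᵢ) = -e^{ηᵢ(z + ωᵢ/2)} σ(z)`).

## Design

* As for `PeriodPair.weierstrassP` (Mathlib) and `PeriodPair.weierstrassZeta` (tree), the product
  runs over the whole lattice with no `l ≠ 0` side condition: with `x / 0 = 0` the `l = 0` factor
  `(1 - z/0)·exp(z/0 + z²/0) = 1` (`sigmaFactor_zero_right`), so `σ(z) = z · ∏'_{l ∈ Λ} …` is the
  classical `z ∏'_{l ≠ 0} …`.
* Proved API: `sigmaFactor_zero_right`, `weierstrassSigma_zero`, `weierstrassSigma_neg` (oddness,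
  unconditionally, by reindexing `l ↦ -l`).
* The analytic properties are named facts (D-0014) with citations: convergence, entireness, zeros,
  `σ'/σ = ζ` (stated with Mathlib's `logDeriv`), quasi-periodicity. The order-2 growth bound used
  with Schwarz's lemma is a consequence of these and is proved (not vendored) in the companion
  `WeierstrassSigmaProofs.lean`.
-/

noncomputable section

open Complex

namespace PeriodPair

variable (L : PeriodPair)

/-- The general factor `(1 - z/l)·exp(z/l + z²/(2l²))` of the Weierstrass product for `σ`
(Whittaker–Watson §20.42). [cite: WhittakerWatson1927, §20.42] -/
def sigmaFactor (z l : ℂ) : ℂ := (1 - z / l) * cexp (z / l + z ^ 2 / (2 * l ^ 2))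

/-- With the junk convention `x / 0 = 0` the factor at `l = 0` is `1`, so that the product over
the whole lattice equals the classical primed product. [folklore] -/
@[simp] lemma sigmaFactor_zero_right (z : ℂ) : sigmaFactor z 0 = 1 := by
  simp [sigmaFactor]

/-- `sigmaFactor (-z) l = sigmaFactor z (-l)`. [folklore] -/
lemma sigmaFactor_neg (z l : ℂ) : sigmaFactor (-z) l = sigmaFactor z (-l) := by
  simp only [sigmaFactor, neg_sq, div_neg, neg_div]

/-- The **Weierstrass sigma function** of the period lattice `L`,
`σ(z) = z ∏'_{l ∈ Λ ∖ {0}} (1 - z/l) exp(z/l + z²/(2l²))`, written as `z` times the product over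
the whole lattice (the `l = 0` factor is `1`, `sigmaFactor_zero_right`). Whittaker–Watson §20.42.
[cite: WhittakerWatson1927, §20.42] -/
def weierstrassSigma (z : ℂ) : ℂ := z * ∏' l : L.lattice, sigmaFactor z l

/-- `σ(0) = 0`. Whittaker–Watson §20.42. [folklore] -/
@[simp] lemma weierstrassSigma_zero : L.weierstrassSigma 0 = 0 := by
  simp [weierstrassSigma]

/-- The sigma function is odd: `σ(-z) = -σ(z)` (Whittaker–Watson §20.42, "`σ(z)` is an odd
integral function"); this holds unconditionally, by reindexing the product along `l ↦ -l`
(`Equiv.tprod_eq` needs no convergence). [cite: WhittakerWatson1927, §20.42] -/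
theorem weierstrassSigma_neg (z : ℂ) : L.weierstrassSigma (-z) = -L.weierstrassSigma z := by
  unfold weierstrassSigma
  rw [← (Equiv.neg L.lattice).tprod_eq (fun l : L.lattice => sigmaFactor z l), neg_mul]
  congr 2
  exact tprod_congr fun l => by simp [sigmaFactor_neg]

/-! ### Analytic properties (named facts) -/

/-- The Weierstrass product for `σ` converges (absolutely) at every `z ∈ ℂ`
(Whittaker–Watson §20.42: it "converges absolutely and uniformly in any bounded domain").
[cite: WhittakerWatson1927, §20.42] -/
def multipliable_sigmaFactor : Prop :=
  ∀ z : ℂ, Multipliable fun l : L.lattice => sigmaFactor z l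

/-- `σ` is an entire (integral) function (Whittaker–Watson §20.42). [cite: WhittakerWatson1927, §20.42] -/
def differentiable_weierstrassSigma : Prop :=
  Differentiable ℂ L.weierstrassSigma

/-- The zeros of `σ` are exactly the lattice points (Whittaker–Watson §20.42; they are moreover
simple, which is not part of this statement). [cite: WhittakerWatson1927, §20.42] -/
def weierstrassSigma_eq_zero_iff : Prop :=
  ∀ z : ℂ, L.weierstrassSigma z = 0 ↔ z ∈ L.lattice

/-- Logarithmic derivative: `σ'(z)/σ(z) = ζ(z)` off the lattice (Whittaker–Watson §20.42:
"`(d/dz) log σ(z) = ζ(z)`"). [cite: WhittakerWatson1927, §20.42] -/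
def logDeriv_weierstrassSigma : Prop :=
  ∀ z : ℂ, z ∉ L.lattice → logDeriv L.weierstrassSigma z = L.weierstrassZeta z

/-- Unfolding `logDeriv` (`Mathlib`: `logDeriv f z = deriv f z / f z`, definitionally). [folklore] -/
lemma logDeriv_weierstrassSigma_iff :
    L.logDeriv_weierstrassSigma ↔
      ∀ z : ℂ, z ∉ L.lattice →
        deriv L.weierstrassSigma z / L.weierstrassSigma z = L.weierstrassZeta z :=
  Iff.rfl

/-- Quasi-periodicity in `ω₁`: `σ(z + ω₁) = -e^{η₁(z + ω₁/2)} σ(z)` (Whittaker–Watson §20.421,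
rewritten from the normalisation with periods `2ωᵢ`, `ηᵢ = ζ(ωᵢ)`).
[cite: WhittakerWatson1927, §20.421] -/
def weierstrassSigma_add_ω₁ : Prop :=
  ∀ z : ℂ, L.weierstrassSigma (z + L.ω₁) =
    -cexp (L.η₁ * (z + L.ω₁ / 2)) * L.weierstrassSigma z

/-- Quasi-periodicity in `ω₂`: `σ(z + ω₂) = -e^{η₂(z + ω₂/2)} σ(z)` (Whittaker–Watson §20.421).
[cite: WhittakerWatson1927, §20.421] -/
def weierstrassSigma_add_ω₂ : Prop :=
  ∀ z : ℂ, L.weierstrassSigma (z + L.ω₂) =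
    -cexp (L.η₂ * (z + L.ω₂ / 2)) * L.weierstrassSigma z

/-! The order-`2` growth bound `‖σ(z)‖ ≤ exp(C(1 + ‖z‖²))` used with Schwarz's lemma
(Chudnovsky 1984, Ch. 7, §2–3) is *not* vendored as a fact: it follows from the quasi-periodicity
facts above and continuity on a fundamental parallelogram, and is proved in the companion file
`WeierstrassSigmaProofs.lean` together with the discharges of the facts of this file. -/

end PeriodPair

end
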